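import Literature.MathematicalPhysics.QuantumFieldTheory.Balaban1983to89.B13NodeTorusFamily
import Literature.MathematicalPhysics.QuantumFieldTheory.Balaban1983to89.B13Lemma3TorusNonvacuity

/-!
# `Balaban1983to89.B13NodeTorusFamilyNonvacuity` — [Balaban1988RG2Cluster] CMP **116** (1988) 1–22, p. 18 ∕ p. 20 (the restrictions on the
# constants) ∕ p. 21 (*"The assumptions allow finally us to fix all the constants"*): the ONE numerics bundle of the history-indexed family
# socket `B13NodeTorusFamily` is INHABITED with a POSITIVE coupling box `γ₀ = γ₀(ε₁) = ε₁/√a`, and the family socket at the named witness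

statement-level bookkeeping over published theorems with citation tags; kernel-checked compositions of tree theorems;
nothing here is a claim about the Yang–Mills mass gap.

CITATION HEADER (lean-in-tree rule).  Source: T. Bałaban, *Renormalization group approach to lattice gauge field theories. II. Cluster
expansions*, Commun. Math. Phys. **116**, 1–22 (1988), doi:10.1007/bf01239022 [Balaban1988RG2Cluster].  p. 18 [PDF 18]: *"Assuming
(1/20)γ₂ε₁²/g_k² ≧ (1/20)γ₂ε₁²/γ² ≧ 4κ"*; p. 20 [PDF 20] Lemma 3: *"Under all the above restrictions on the constants M, κ, κ₁, α₀, α₁, α₄, α₆,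
γ₂, γ, ε₁ …"*; p. 21 [PDF 21]: *"The assumptions allow finally us to fix all the constants"*; [Balaban1987RG1] Thm 1 p. 259: the interval
constant γ *"sufficiently small"* given the other constants.  Seat `pub-ymgap-dag-p2` = n10-a (YM-PLAN Track A, HUMAN RULING D-0062), generation
g4, module 3.  BY NAME and UNCHANGED: `…B13Lemma3TorusNonvacuity` (lit-balaban r10: the named witness `consts` (L = 8, γ₂ = γ = 1, ε₁ = `ε₁t`), the
rate `B13Lemma3WindowNonvacuity.aw`, `numerics_nonvacuous_pos_consts` = the 41 Lemma-3 conjuncts AT the witness), `…B13Lemma3TorusSocket`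
(`Lemma3Numerics`, `TermDomination`, `Termwise226`), `…B13NodeTorusFamily` (module 2: `b13Family_of_termwise`, `b13Family_stepData`).

WHAT THIS FILE PROVES (0 `sorry`, 0 `def`, standard axioms).
§1 `numerics_consts` — the 25-field bundle `Lemma3Numerics consts 1 (consts.L/2) aw 1 1 ½ 1` PACKAGED from the landed conjunct list
   (`numerics_nonvacuous_pos_consts`; first packaging of the structure at a named record in the tree); `aw_pos` (`0 < aw`, read off the (2.31)
   conjunct `8e^{−a/10} ≤ a/20`).
§2 **`family_numerics_nonvacuous`** — `∃ γ₀ > 0, Lemma3Numerics consts 1 (consts.L/2) (consts.γ₂·consts.ε₁²/γ₀²) 1 1 ½ 1`: with the box constant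
   `γ₀ := ε₁/√a` (γ₂ = 1) the box-minimal |P|-rate `γ₂ε₁²/γ₀²` IS the witness rate `a` (`rate_at_gamma0`), so module 2's ONE-bundle hypothesis
   `hN` is inhabited TOGETHER WITH a positive coupling box — the reading «γ₀ small given ε₁» ([I] Thm 1) as a kernel fact about the typed list.
§3 **`b13Family_consts`** — the family socket AT THE WITNESS: for any history-indexed family of two-scale torus steps with L = 8 = `consts.L`,
   bond cubes of side 1, Lemma 1 ∧ 2 per member, termwise domination and (2.26) per term at the natural rate `ε₁²/g_k²` (γ₂ = 1) with `a₅ = ½`,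
   the triple `Lemma1Printed ∧ Lemma2Printed ∧ Lemma3Printed` holds for EVERY (k, v) with `v ∈ ]0, ε₁/√a]^{k+1}` — NO numerical hypothesis left.

HONEST FRAMING.  Consistency of the typed inequality list with a positive box, at lit-balaban's explicit witness (which certifies the NUMBERS
are jointly satisfiable, not that Bałaban's objects meet the structural hypotheses); count-neutral; N10 NOT discharged; nothing continuum ∕
ℝ⁴ ∕ OS ∕ mass gap ∕ Clay.  No `sorry`, no definition, no new named fact.
-/

noncomputable section

namespace Literature.MathematicalPhysics.QuantumFieldTheory.Balaban1983to89.B13NodeTorusFamilyNonvacuity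

open Literature.MathematicalPhysics.QuantumFieldTheory.Balaban1983to89
open Literature.MathematicalPhysics.QuantumFieldTheory.Balaban1983to89.TreeLengthTorus (TDom)
open Literature.MathematicalPhysics.QuantumFieldTheory.Balaban1983to89.B13Lemma3TorusData (TBond)
open Literature.MathematicalPhysics.QuantumFieldTheory.Balaban1983to89.B13Lemma3Torus (TwoTorusStep)
open Literature.MathematicalPhysics.QuantumFieldTheory.Balaban1983to89.B13Lemma3TorusSocket
  (TermDomination Termwise226 Lemma3Numerics)
open Literature.MathematicalPhysics.QuantumFieldTheory.Balaban1983to89.B13Lemma3WindowNonvacuity (aw)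
open Literature.MathematicalPhysics.QuantumFieldTheory.Balaban1983to89.B13Lemma3TorusNonvacuity
  (consts numerics_nonvacuous_pos_consts consts_L)
open Literature.MathematicalPhysics.QuantumFieldTheory.Balaban1983to89.B13NodeTorusFamily (b13Family_of_termwise b13Family_stepData)
open Literature.MathematicalPhysics.QuantumFieldTheory.Balaban1983to89.FlowStep (Box)

/-! ## §1. The numerics bundle at the named witness -/

/-- **`Lemma3Numerics` PACKAGED at lit-balaban's named witness** `consts` (L = 8), bond-cube side 1, rate `aw`, `a₂ = a₂′ = 1`, `a₅ = ½`,
`Aabs = 1`: the 25 fields read off the landed conjunct list `numerics_nonvacuous_pos_consts` (restrictions R15–R18, R20, the (2.29)∕(2.31)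
smallness, the absorption into C₃ε₁). [cite: Balaban1988RG2Cluster, pp.17–20 (restrictions on the constants), p.21 (closing paragraph)] -/
theorem numerics_consts : Lemma3Numerics consts 1 ((consts.L : ℝ) / 2) aw 1 1 (1 / 2) 1 := by
  obtain ⟨-, -, -, hα₆, heps2, hδ, hδ7, hκ, ha, hR15, hR16, hR16', hR17, h231, ha₂, hκ229, hsm229, habsk, h18half, h18,
    ha₂', hκ229', hsm229', hR20, ha₅, habs, hAc, hC3, -⟩ := numerics_nonvacuous_pos_consts
  have hℓ : (0 : ℝ) ≤ (consts.L : ℝ) / 2 := by positivity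
  exact ⟨hℓ, hα₆, heps2, hδ, hδ7, hκ, ha, hR15, hR16, hR16', hR17, h231, ha₂, hκ229, hsm229, habsk, h18half, h18, ha₂', hκ229',
    hsm229', hR20, ha₅, habs, hAc, hC3⟩

/-- The witness rate is positive (from the (2.31) conjunct `2·4·1⁴·e^{−a/10} ≤ a/20`). [cite: Balaban1988RG2Cluster, (2.31) p.18] -/
theorem aw_pos : 0 < aw := by
  obtain ⟨-, -, -, -, -, -, -, -, -, -, -, -, -, h231, -⟩ := numerics_nonvacuous_pos_consts
  have h8 : (0 : ℝ) < 2 * 4 * ((1 : ℕ) : ℝ) ^ 4 * Real.exp (-(aw / 10)) := by positivity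
  linarith

/-- The witness's γ₂ and ε₁ (definitional). [cite: Balaban1988RG2Cluster, p.21 (closing paragraph)] -/
theorem consts_γ₂ : consts.γ₂ = 1 := rfl

/-- `0 < consts.ε₁`. [cite: Balaban1988RG2Cluster, p.21 (closing paragraph)] -/
theorem consts_ε₁_pos : 0 < consts.ε₁ := numerics_nonvacuous_pos_consts.2.2.1

/-! ## §2. A positive coupling box for the ONE-bundle family socket -/

/-- **At the box constant `γ₀ := ε₁/√a` the box-minimal |P|-rate IS the witness rate**: `consts.γ₂·consts.ε₁²/γ₀² = aw`.
[cite: Balaban1988RG2Cluster, p.18 («(1/20)γ₂ε₁²/g_k² ≧ (1/20)γ₂ε₁²/γ²»)] -/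
theorem rate_at_gamma0 : consts.γ₂ * consts.ε₁ ^ 2 / (consts.ε₁ / Real.sqrt aw) ^ 2 = aw := by
  have ha : 0 < aw := aw_pos
  have hε : 0 < consts.ε₁ := consts_ε₁_pos
  have hs : 0 < Real.sqrt aw := Real.sqrt_pos.2 ha
  rw [consts_γ₂, div_pow, Real.sq_sqrt ha.le]
  field_simp

/-- `γ₀ := ε₁/√a` is positive. [cite: Balaban1987RG1, Thm 1 p.259 («γ sufficiently small»; bookkeeping)] -/
theorem gamma0_pos : 0 < consts.ε₁ / Real.sqrt aw := div_pos consts_ε₁_pos (Real.sqrt_pos.2 aw_pos)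

/-- **NON-VACUITY OF THE FAMILY SOCKET'S NUMERICS WITH A POSITIVE BOX**: there is `γ₀ > 0` (namely `ε₁/√a`) at which the ONE bundle of Lemma 3's
restrictions at the box-minimal rate `γ₂ε₁²/γ₀²` — hypothesis `hN` of `B13NodeTorusFamily.bound238_family ∕ b13Family_of_termwise` — holds at the
named witness. [cite: Balaban1988RG2Cluster, p.18, Lemma 3 p.20, p.21 (closing paragraph); Balaban1987RG1, Thm 1 p.259] -/
theorem family_numerics_nonvacuous :
    ∃ γ₀ : ℝ, 0 < γ₀ ∧ Lemma3Numerics consts 1 ((consts.L : ℝ) / 2) (consts.γ₂ * consts.ε₁ ^ 2 / γ₀ ^ 2) 1 1 (1 / 2) 1 :=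
  ⟨consts.ε₁ / Real.sqrt aw, gamma0_pos, by rw [rate_at_gamma0]; exact numerics_consts⟩

/-- The same with the constants record existential too (the shape a consumer quantifying over `c` reads), with `8 ≤ c.L`, `0 ≤ c.γ₂` for
module 2's side conditions. [cite: Balaban1988RG2Cluster, p.21 (closing paragraph)] -/
theorem family_numerics_nonvacuous' :
    ∃ (c : B13.Consts) (γ₀ : ℝ), 8 ≤ c.L ∧ 0 ≤ c.γ₂ ∧ 0 < γ₀ ∧
      Lemma3Numerics c 1 ((c.L : ℝ) / 2) (c.γ₂ * c.ε₁ ^ 2 / γ₀ ^ 2) 1 1 (1 / 2) 1 :=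
  ⟨consts, consts.ε₁ / Real.sqrt aw, by rw [consts_L], by rw [consts_γ₂]; exact zero_le_one, gamma0_pos,
    by rw [rate_at_gamma0]; exact numerics_consts⟩

/-! ## §3. The family socket at the witness: no numerical hypothesis left -/

section AtWitness

variable {N' : (k : ℕ) → (Fin (k + 1) → ℝ) → ℕ} [∀ k v, NeZero (N' k v)]

open Classical in
/-- **THE B13 LEAF TRIPLE FOR EVERY (k, v) IN THE BOX `]0, ε₁/√a]^{k+1}`, AT THE NAMED WITNESS** (L = 8, bond cubes of side 1, γ₂ = 1, a₅ = ½):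
for any history-indexed family of two-scale torus steps `Wt k v : TwoTorusStep 4 8 (N′ k v)` with Lemma 1 ∧ 2 per member (`h12`), termwise
domination (`hH`) and (2.26) per term at the natural rate `consts.γ₂·consts.ε₁²/g_k²` (`h226`), the triple holds for every member — module 2's
`b13Family_of_termwise` with its numerics bundle DISCHARGED by `numerics_consts` at `γ₀ = ε₁/√a`. [cite: Balaban1988RG2Cluster, Lemmas 1–3 pp.9, 11, 20; p.18; p.21] -/
theorem b13Family_consts
    (Wt : (k : ℕ) → (v : Fin (k + 1) → ℝ) → TwoTorusStep 4 8 (N' k v))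
    (T₃ : (k : ℕ) → (v : Fin (k + 1) → ℝ) → (Z : TDom 4 (N' k v)) →
      Finset (TDom 4 (8 * N' k v)) × Finset (TBond 4 1 (8 * N' k v)) → (Wt k v).Φ → ℂ)
    (h12 : ∀ k v, v ∈ Box (consts.ε₁ / Real.sqrt aw) k →
      B13.Lemma1Printed (Wt k v).toStepData consts ∧ B13.Lemma2Printed (Wt k v).toStepData consts)
    (hH : ∀ k v, v ∈ Box (consts.ε₁ / Real.sqrt aw) k → TermDomination 1 (Wt k v) (T₃ k v))
    (h226 : ∀ k v, v ∈ Box (consts.ε₁ / Real.sqrt aw) k →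
      Termwise226 consts (consts.γ₂ * consts.ε₁ ^ 2 / (v (Fin.last k)) ^ 2) (1 / 2) (Wt k v) (T₃ k v)) :
    ∀ k v, v ∈ Box (consts.ε₁ / Real.sqrt aw) k →
      B13.Lemma1Printed (Wt k v).toStepData consts ∧ B13.Lemma2Printed (Wt k v).toStepData consts ∧
        B13.Lemma3Printed (Wt k v).toStepData consts := by
  have hN : Lemma3Numerics consts 1 ((consts.L : ℝ) / 2) (consts.γ₂ * consts.ε₁ ^ 2 / (consts.ε₁ / Real.sqrt aw) ^ 2)
      1 1 (1 / 2) 1 := by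
    rw [rate_at_gamma0]
    exact numerics_consts
  exact b13Family_of_termwise (L := 8) consts (by rw [consts_L]) consts_L (by rw [consts_γ₂]; exact zero_le_one) Wt 1 T₃
    h12 hH h226 hN

open Classical in
/-- … and for any family of step data pinned to the torus records on the box (the dagwriter's `b13` family predicate at `c13 := consts`,
`γ13 := ε₁/√a`). [cite: Balaban1988RG2Cluster, Lemmas 1–3 pp.9, 11, 20] -/
theorem b13Family_stepData_consts (S : (k : ℕ) → (Fin (k + 1) → ℝ) → B13.StepData)
    (Wt : (k : ℕ) → (v : Fin (k + 1) → ℝ) → TwoTorusStep 4 8 (N' k v))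
    (hS : ∀ k v, v ∈ Box (consts.ε₁ / Real.sqrt aw) k → S k v = (Wt k v).toStepData)
    (T₃ : (k : ℕ) → (v : Fin (k + 1) → ℝ) → (Z : TDom 4 (N' k v)) →
      Finset (TDom 4 (8 * N' k v)) × Finset (TBond 4 1 (8 * N' k v)) → (Wt k v).Φ → ℂ)
    (h12 : ∀ k v, v ∈ Box (consts.ε₁ / Real.sqrt aw) k →
      B13.Lemma1Printed (Wt k v).toStepData consts ∧ B13.Lemma2Printed (Wt k v).toStepData consts)
    (hH : ∀ k v, v ∈ Box (consts.ε₁ / Real.sqrt aw) k → TermDomination 1 (Wt k v) (T₃ k v))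
    (h226 : ∀ k v, v ∈ Box (consts.ε₁ / Real.sqrt aw) k →
      Termwise226 consts (consts.γ₂ * consts.ε₁ ^ 2 / (v (Fin.last k)) ^ 2) (1 / 2) (Wt k v) (T₃ k v)) :
    ∀ k v, v ∈ Box (consts.ε₁ / Real.sqrt aw) k →
      B13.Lemma1Printed (S k v) consts ∧ B13.Lemma2Printed (S k v) consts ∧ B13.Lemma3Printed (S k v) consts := by
  intro k v hv
  rw [hS k v hv]
  exact b13Family_consts Wt T₃ h12 hH h226 k v hv

end AtWitness

end Literature.MathematicalPhysics.QuantumFieldTheory.Balaban1983to89.B13NodeTorusFamilyNonvacuity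

end
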